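import Summits.NavierStokesRegularity.NavierStokesRegularity.Theorems.StrainClockLocalCompositions
import HarnessLib

/-!
# StrainClockLocalCompositionsB — S39 compositions II (§4: `integratedClockNoStretching_of`, `integratedClockLiouville_of`)

P0-39 part 3 of 4: §4 second half (`integratedClockNoStretching_of`, `integratedClockLiouville_of`) of nsreg-p1 g32's `r37/Sketch39.v2.lean` sha16 8afe3b1c706e6582 (ROUND-37 S39 «LocalStrainClock»
65850a92b7bcd814), every declaration byte-identical, order preserved; cut prepared by ns-s29-p2 g4 (planner's suggested split,
compositions halved for the 400-line cap), `--supports stmt-NavierStokesRegularity-0056 --as helper`.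

HONEST FRAME: door family S39 «LocalStrainClock» = local / penalised / integrated strain-clock CRITERIA about HYPOTHETICAL blow-up
profiles; items 0056 `NoTypeII`, 10661 and NS regularity are NOT proved; nothing here is a route or a summit statement.
-/

noncomputable section

open MeasureTheory Set Function Filter Metric Real InnerProductSpace
open _root_.Topology
open scoped ENNReal NNReal RealInnerProductSpace ContDiff Laplacian Interval
open Literature.Analysis Literature.Analysis.FluidPDE
open Literature.Analysis.FluidPDE.VorticityDirectionDynamics

set_option linter.dupNamespace false

namespace Summit.NavierStokesRegularity.NavierStokesRegularity.Theorems.StrainDoors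

open Summit.NavierStokesRegularity.NavierStokesRegularity.Theorems.ArgmaxDoors

-- nested operator types (second derivatives)
set_option maxSynthPendingDepth 3
/-- **Door C4♮ «IntegratedClockNoStretching» from the plates** (`StrainFrameOn → StrainThresholdOn → …`): on every
backward slab the barrier `B = (L'⁻¹ + ∫_{s₁}^{s}(1−θ))⁻¹` (`B' = −(1−θ)B² = φB`, `φ = −(1−θ)B`; the integrand is
continuous and `≥ 0`); growth `∂ₛq ≤ −(1−θ(s))q² + η(ε)q ≤ (φ + η(ε))q` at charged points; start `q(s₁) ≤ L' = B(s₁)`;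
then the divergent deficit sends `B(s₂) → 0`. [folklore] -/
theorem integratedClockNoStretching_of (hFr : StrainFrameOn) (hTh : StrainThresholdOn) :
    IntegratedClockNoStretching := by
  intro ν U L δ θ hν hδ hδ1 hθc hθ1 hdiv u p hS hU hL hhyp s₂ hs₂ x e he
  set L' : ℝ := max L 1 with hL'
  have hL'0 : 0 < L' := lt_of_lt_of_le one_pos (le_max_right _ _)
  have hL'b : ∀ s : ℝ, s < 0 → ∀ y : EuclideanSpace ℝ (Fin 3), ‖fderiv ℝ (u s) y‖ ≤ L' :=
    fun s hs y => (hL s hs y).trans (le_max_left _ _)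
  have hgc : Continuous fun r : ℝ => 1 - θ r := continuous_const.sub hθc
  -- ### the one-slab bound
  have hslab : ∀ s₁ : ℝ, s₁ < s₂ → strainQuad u s₂ x e ≤ (L'⁻¹ + ∫ r in s₁..s₂, (1 - θ r))⁻¹ := by
    intro s₁ h12
    have hsol := hS s₁ s₂ h12 hs₂
    set I : ℝ → ℝ := fun s => ∫ r in s₁..s, (1 - θ r) with hI
    have hId : ∀ s : ℝ, HasDerivAt I (1 - θ s) s := fun s =>
      (hgc.integral_hasStrictDerivAt s₁ s).hasDerivAt
    have hI0 : ∀ s : ℝ, s₁ ≤ s → 0 ≤ I s := fun s hs =>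
      intervalIntegral.integral_nonneg hs fun r _ => sub_nonneg.2 (hθ1 r)
    set D : ℝ → ℝ := fun s => L'⁻¹ + I s with hD
    have hDpos : ∀ s ∈ Icc s₁ s₂, 0 < D s := fun s hs => by
      have h1 := hI0 s hs.1
      have h2 : 0 < L'⁻¹ := inv_pos.2 hL'0
      simp only [hD]
      linarith
    set B : ℝ → ℝ := fun s => (D s)⁻¹ with hB
    set B' : ℝ → ℝ := fun s => -(1 - θ s) / (D s) ^ 2 with hB'
    set φ : ℝ → ℝ := fun s => -(1 - θ s) * B s with hφ
    have hDd : ∀ s : ℝ, HasDerivAt D (1 - θ s) s := fun s => (hId s).const_add L'⁻¹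
    have hBc : ContinuousOn B (Icc s₁ s₂) := by
      have hDc : Continuous D := continuous_iff_continuousAt.2 fun s => (hDd s).continuousAt
      exact hDc.continuousOn.inv₀ fun s hs => (hDpos s hs).ne'
    have hBpos : ∀ s ∈ Icc s₁ s₂, 0 < B s := fun s hs => by
      simp only [hB]
      exact inv_pos.2 (hDpos s hs)
    have hBd : ∀ s ∈ Icc s₁ s₂, HasDerivWithinAt B (B' s) (Icc s₁ s₂) s := fun s hs =>
      ((hDd s).inv (hDpos s hs).ne').hasDerivWithinAt
    have hsuper : ∀ s ∈ Icc s₁ s₂, φ s * B s ≤ B' s := by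
      intro s hs
      have hD0 : D s ≠ 0 := (hDpos s hs).ne'
      simp only [hφ, hB, hB']
      rw [div_eq_mul_inv, ← inv_pow]
      apply le_of_eq
      ring
    have hrate : ∀ ε : ℝ, 0 < ε → ε ≤ 1 → ∀ s ∈ Ioc s₁ s₂, ∀ (x e : EuclideanSpace ℝ (Fin 3)), ‖e‖ = 1 →
        (∀ (y e' : EuclideanSpace ℝ (Fin 3)), ‖e'‖ = 1 →
          (1 + ε * ‖y‖ ^ 2)⁻¹ * strainQuad u s y e' ≤ (1 + ε * ‖x‖ ^ 2)⁻¹ * strainQuad u s x e) →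
        (∀ (y e' : EuclideanSpace ℝ (Fin 3)), ‖e'‖ = 1 → (1 - δ) * strainQuad u s y e' ≤ strainQuad u s x e) →
        B s < strainQuad u s x e →
        strainRateOn (Icc s₁ s₂) u s x e ≤ (φ s + (6 * ν * ε + Real.sqrt ε * U)) * strainQuad u s x e := by
      intro ε hε _ s hs x e he hpen halm hbig
      have hs0 : s < 0 := lt_of_le_of_lt hs.2 hs₂
      have hsI : s ∈ Icc s₁ s₂ := ⟨hs.1.le, hs.2⟩
      have hBs := hBpos s hsI
      have hq0 : 0 < strainQuad u s x e := hBs.trans hbig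
      have hsm : ContDiff ℝ ∞ (u s) := hsol.smooth_velocity.contDiff_slice hsI
      have heq := hFr ν s₁ s₂ h12 u p hsol s hsI x e
      have hE := strainGrowthWeighted ν ε hν.le hε (u s) (p s) hsm x e he (fun y => hpen y e he) hq0.le _ heq
      have hfeed := hhyp s hs0 x e ⟨he, halm⟩ hq0
      have hux : ‖u s x‖ ≤ U := hU s hs0 x
      have h1 : strainRateOn (Icc s₁ s₂) u s x e ≤ -(strainQuad u s x e) ^ 2 + strainFeed u p s x e +
          (6 * ν * ε + Real.sqrt ε * ‖u s x‖) * strainQuad u s x e := by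
        unfold strainRateOn strainQuad strainFeed pressureHess
        linarith [hE]
      have hallow : (6 * ν * ε + Real.sqrt ε * ‖u s x‖) * strainQuad u s x e ≤
          (6 * ν * ε + Real.sqrt ε * U) * strainQuad u s x e := by
        apply mul_le_mul_of_nonneg_right _ hq0.le
        have := mul_le_mul_of_nonneg_left hux (Real.sqrt_nonneg ε)
        linarith
      have hθs : 0 ≤ 1 - θ s := sub_nonneg.2 (hθ1 s)
      have hκq : -(strainQuad u s x e) ^ 2 + θ s * strainQuad u s x e ^ 2 ≤ φ s * strainQuad u s x e := by
        have h2 : φ s = -(1 - θ s) * B s := rfl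
        have h3 : (1 - θ s) * (B s * strainQuad u s x e) ≤
            (1 - θ s) * (strainQuad u s x e * strainQuad u s x e) :=
          mul_le_mul_of_nonneg_left (mul_le_mul_of_nonneg_right hbig.le hq0.le) hθs
        have h4 : -(strainQuad u s x e) ^ 2 + θ s * strainQuad u s x e ^ 2 =
            -(1 - θ s) * (strainQuad u s x e * strainQuad u s x e) := by ring
        rw [h2, h4]
        linarith [h3]
      linarith [h1, hallow, hfeed, hκq]
    have hinit : ∀ (x e : EuclideanSpace ℝ (Fin 3)), ‖e‖ = 1 → strainQuad u s₁ x e ≤ B s₁ := by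
      intro y e' he'
      have h1 : B s₁ = L' := by
        simp only [hB, hD, hI, intervalIntegral.integral_same, add_zero, inv_inv]
      rw [h1]
      exact (strainQuad_le_opNorm u s₁ y he').trans (hL'b s₁ (h12.trans hs₂) y)
    have hKb : ∀ s ∈ Icc s₁ s₂, ∀ y : EuclideanSpace ℝ (Fin 3), ‖fderiv ℝ (u s) y‖ ≤ L' :=
      fun s hs y => hL'b s (lt_of_le_of_lt hs.2 hs₂) y
    have hmain := hTh ν s₁ s₂ δ (fun ε => 6 * ν * ε + Real.sqrt ε * U) hν h12 hδ hδ1 (tendsto_allowance ν U)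
      u p hsol ⟨L', hKb⟩ B B' φ hBc hBpos hBd hsuper hrate hinit s₂ ⟨h12.le, le_rfl⟩ x e he
    exact hmain
  -- ### the divergent deficit
  by_contra hpos
  push Not at hpos
  obtain ⟨s₁, h12, hM⟩ := hdiv s₂ hs₂ (2 / strainQuad u s₂ x e)
  have h := hslab s₁ h12
  have h5 : 0 < 2 / strainQuad u s₂ x e := div_pos two_pos hpos
  have hIpos : 0 < ∫ r in s₁..s₂, (1 - θ r) := h5.trans_le hM
  have h4 : (∫ r in s₁..s₂, (1 - θ r)) < L'⁻¹ + ∫ r in s₁..s₂, (1 - θ r) := by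
    have := inv_pos.2 hL'0
    linarith
  have h6 : (L'⁻¹ + ∫ r in s₁..s₂, (1 - θ r))⁻¹ < (∫ r in s₁..s₂, (1 - θ r))⁻¹ :=
    (inv_lt_inv₀ (hIpos.trans h4) hIpos).2 h4
  have h7 : (∫ r in s₁..s₂, (1 - θ r))⁻¹ ≤ (2 / strainQuad u s₂ x e)⁻¹ := inv_anti₀ h5 hM
  rw [inv_div] at h7
  have h8 : strainQuad u s₂ x e / 2 < strainQuad u s₂ x e := by linarith
  linarith

/-- **Door C4 from C4♮ and «RigidMotion»**. [folklore] -/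
theorem integratedClockLiouville_of (hN : IntegratedClockNoStretching) (hR : RigidMotion) :
    IntegratedClockLiouville := by
  intro ν U L δ θ hν hδ hδ1 hθc hθ1 hdiv u p hS hU hL hhyp s hs
  exact const_of_strainQuad_nonpos hR hS hU hs fun x e he =>
    hN ν U L δ θ hν hδ hδ1 hθc hθ1 hdiv u p hS hU hL hhyp s hs x e he

end Summit.NavierStokesRegularity.NavierStokesRegularity.Theorems.StrainDoors

end
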